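import Summits.RiemannHypothesis.RiemannHypothesis.Theorems.JensenPolynomialsCapCertCompute

/-!
# Route `JensenPolynomials` — `XiCumulantMajorantCap` / `XiCumulantMajorantCapFar` kernel packaging:
KERNEL-ONLY certificate runs of `capCheck` for the low degrees `3 ≤ d ≤ 99` (cell rh-jensen, engine seat g4)

RH-FREE, γ-FREE proof-of-data (rung J-P(P1′); crux children stmt-RiemannHypothesis-19217 / -19472).  The per-degree
checker `capCheck` of part 1 (engine seat eng-2, `JensenPolynomialsCapCertCompute`) is evaluated here by the KERNEL
(`decide +kernel`, standard axioms — no `native_decide`) for every degree `3 ≤ d ≤ 99`, in three chunks.  Together with the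
soundness of the checker (`capCheckRange_sound`, part 6) this gives both majorant sums `< 1` for `3 ≤ d ≤ 99`; the degrees
`d ≥ 100` are ALL covered at once by the uniform tail certificate (`JensenPolynomialsCapTail*`), so the whole child closes
under the standard axioms.  (The computational runs `capCheckRange_3 …` of `JensenPolynomialsCapCertRuns` cover
`3 ≤ d ≤ 3000` by `native_decide`; this file is the kernel-only twin of their low end.)  Nothing here bears on the truth of RH.
-/

-- D-0017: `Summit.RiemannHypothesis.RiemannHypothesis.…` duplicates the namespace BY DESIGN (single-problem summit).
set_option linter.dupNamespace false

namespace Summit.RiemannHypothesis.RiemannHypothesis.Theorems.JensenPolynomials.CapCert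

/-- Kernel-only certificate run (standard axioms): every `3 ≤ d < 40` passes `capCheck`. -/
theorem capCheckRange_3_37_kernel : capCheckRange 3 37 = true := by
  set_option maxRecDepth 100000 in decide +kernel

/-- Kernel-only certificate run (standard axioms): every `40 ≤ d < 70` passes `capCheck`. -/
theorem capCheckRange_40_30_kernel : capCheckRange 40 30 = true := by
  set_option maxRecDepth 100000 in decide +kernel

/-- Kernel-only certificate run (standard axioms): every `70 ≤ d < 100` passes `capCheck`. -/
theorem capCheckRange_70_30_kernel : capCheckRange 70 30 = true := by
  set_option maxRecDepth 100000 in decide +kernel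

end Summit.RiemannHypothesis.RiemannHypothesis.Theorems.JensenPolynomials.CapCert
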